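import Summits.ResolutionOfSingularities.ResolutionOfSingularities.Theorems.HomologicalConductorGlobalisationK51ClosedPointLocality

/-!
# [OURS · L1 W5.1′] Where `GlobalisationZeroDim` sits: with `CaLocalAtClosedPoints` it implies the crux
# `HomologicalConductor.Globalisation` BY NAME (theorems only)

Cell `res-hironaka`, LADDER-RESOLUTION rung L, row L-G5, slot W5.1′ «canonical ca-tower at closed points»
(register word «ABSORBED → W5.2 — OBJECTION PENDING», director-resolution 2026-08-27T00:40:38Z). The director's
re-open condition (ii) asked the OURS typer o5 for «the §5 sentence ‹CaLocalAtClosedPoints p ∧ VT_p on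
zero-dimensional valuations ⟹ ResolutionInChar p› TYPED as an OURS statement, statement-only, `--supports
stmt-ResolutionOfSingularities-16486`»; the kill-test seat res-L1-k51 typed exactly that pair as
`CaLocalAtClosedPoints p` / `GlobalisationZeroDim p` (p478449, imported here) before this seat reached it, and the
typer has REVIEWED that file instead of duplicating it (binder by binder: the inserted hypothesis «every `t ∈ O`
satisfies a non-zero `f ∈ k[X]` with `f(t) = 0` or `f(t)` a non-unit of `O`» = «the residue field of `O` is algebraic
over `k`» = zero-dimensional valuation; the rest of the antecedent is the route's `let`-telescope VERBATIM, universe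
`Type` as in the route). This companion adds the two pure-logic ANCHORS the refuter pass of condition (ii) starts
from — they say where the typed statement sits relative to the crux, nothing more:

* `globalisation_of_globalisationZeroDim` — `(∀ p prime, CaLocalAtClosedPoints p) → (∀ p prime, GlobalisationZeroDim p)
  → Globalisation`: the crux's antecedent `VT_p` (termination along EVERY valuation ring) trivially contains the
  zero-dimensional antecedent `VT_p⁰` (termination along the valuation rings with algebraic residue field), so the
  typed pair CLOSES THE CRUX BY NAME. In particular the pair is AT LEAST AS STRONG as `Globalisation`; the director's
  probe «does the typed implication close cheaply from tree theorems — then it is bookkeeping» is therefore the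
  question whether `GlobalisationZeroDim p` is provable (k51 §5 sketch: noetherian stabilisation + Chevalley +
  place extension — NOT in the tree), not whether it is implied by the crux.
* `resolutionInChar_of_globalisationZeroDim` — the same at one prime `p`, with the crux's antecedent `VT_p` written
  out (verbatim telescope): `CaLocalAtClosedPoints p → GlobalisationZeroDim p → VT_p → ResolutionInChar p`.

HONEST FRAMING. OURS bookkeeping over typed OURS statements; no statement of H. Hironaka's manuscript [Hironaka2017]
is involved (the slot is a rescue line of the cell, not a reading of the manuscript); `CaLocalAtClosedPoints` is OPEN
(K5.1b) and `GlobalisationZeroDim` unproved — nothing here asserts either. AI review is weaker than expert review.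

References (context only): L/res-L1-k51/KILL-TEST-K5.1-k51.md §5; HOME/INBOX director-resolution 2026-08-27T00:40:38Z
(to res-L1-k51, cc res-L1-type-o5); `Theorems/HomologicalConductorGlobalisation.lean`
(`globalisation_iff_forall_twoModelPatching`, the patching reading of the same crux). [IyengarTakahashi2014]
[ZariskiSamuel1960]
-/

-- single-problem summit: the doubled namespace component `ResolutionOfSingularities` is forced
set_option linter.dupNamespace false

namespace Summit.ResolutionOfSingularities.ResolutionOfSingularities.Theorems

open Summit.ResolutionOfSingularities.ResolutionOfSingularities.Theses.HomologicalConductor (Globalisation)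

/-- **The typed zero-dimensional pair closes the crux by name**: closed-point locality of `ca` at every prime and
`GlobalisationZeroDim` at every prime give `HomologicalConductor.Globalisation` — because the crux's antecedent
(termination of the canonical ca-tower along EVERY valuation ring) contains the zero-dimensional antecedent
(termination along the valuation rings with residue field algebraic over `k`). Pure logic on the verbatim
telescopes. [folklore] -/
theorem globalisation_of_globalisationZeroDim
    (hca : ∀ p : ℕ, p.Prime → CaLocalAtClosedPoints p)
    (hzd : ∀ p : ℕ, p.Prime → GlobalisationZeroDim p) : Globalisation := by
  intro p hp hVT
  refine hzd p hp (hca p hp) ?_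
  intro k K _ _ _ _ O A hk hA hfrac hAO _hzero
  exact hVT k K O A hk hA hfrac hAO

/-- **The same at one prime**, with the crux's antecedent `VT_p` written out (the `let`-telescope of
`Theses/HomologicalConductor.lean`, verbatim): `CaLocalAtClosedPoints p`, `GlobalisationZeroDim p` and valuative
termination along every valuation ring give `ResolutionInChar p`. Pure logic. [folklore] -/
theorem resolutionInChar_of_globalisationZeroDim (p : ℕ) (hca : CaLocalAtClosedPoints p)
    (hzd : GlobalisationZeroDim p)
    (hVT : ∀ (k K : Type) [Field k] [CharP k p] [Field K] [Algebra k K] (O : ValuationSubring K) (A : Subalgebra k K), (∀ c : k, algebraMap k K c ∈ O) → A.FG → IsFractionRing ↥A K → A.toSubring ≤ O.toSubring → let ca : Subalgebra k K → Set K := fun A => {x : K | ∃ hx : x ∈ A, ∃ n : ℕ, ∀ i : ℕ, n ≤ i → ∀ (M N : ModuleCat.{0} ↥A), Module.Finite ↥A M → Module.Finite ↥A N → ∀ e : CategoryTheory.Abelian.Ext.{0} M N i, (⟨x, hx⟩ : ↥A) • e = 0}; let loc : Subalgebra k K → Subalgebra k K := fun A => Algebra.adjoin k {y : K | ∃ a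 ∈ A, ∃ s ∈ A, s⁻¹ ∈ O ∧ y = a * s⁻¹}; let chart : Subalgebra k K → Subalgebra k K := fun A => Algebra.adjoin k ((A : Set K) ∪ {y : K | ∃ c ∈ ca A, ∃ x ∈ ca A, x ≠ 0 ∧ (∀ c' ∈ ca A, c' * x⁻¹ ∈ O) ∧ y = c * x⁻¹}); let nrm : Subalgebra k K → Subalgebra k K := fun B => Algebra.adjoin k {y : K | IsIntegral ↥B y}; let tower : Subalgebra k K → ℕ → Subalgebra k K := fun A m => @Nat.rec (fun _ => Subalgebra k K) (loc A) (fun _ B => loc (nrm (chart B))) m; ∃ m : ℕ, IsRegularLocalRing ↥(tower A m)) :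
    Literature.AlgebraicGeometry.Resolution.ResolutionInChar.{0} p := by
  refine hzd hca ?_
  intro k K _ _ _ _ O A hk hA hfrac hAO _hzero
  exact hVT k K O A hk hA hfrac hAO

end Summit.ResolutionOfSingularities.ResolutionOfSingularities.Theorems
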